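import Summits.ABC.IUTFork.Thm311RealInd1StripTwistMover
import HarnessLib

/-!
# [IUTchIII] Thm 3.11 (i) (Ind1) at `v ∈ 𝕍^non`: region-rigidity under ONE realised twist plane ⟺ the plane is `v`-adically
# SHORT — a parity-free dichotomy (either a ball is inflated, or `‖y_a‖ = ‖y_b‖` and `|y_b^*(x)|·‖y_a‖ ≤ ‖x‖`)

PROOF-ONLY file (abc-iut cell, Cor. 3.12 sub-crew, seat abc-iut-c312-1 = holder of record of the typed [IUTchIII] Thm. 3.11,
gen 10; row «R11 IND1-STRIP-MOVER-ALL-PLANES», part f).  TAKES NO SIDE on [IUTchIII] Cor. 3.12.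

The movers of gen 9 / gen 10 (`f(v|p) = 1`, p467710; `f(v|p)` odd, p479901 / p481941) are COUNTING arguments and do not reach
`f(v|p)` even.  This file records what stability of ALL the balls `𝔪_v^m` under ONE twist plane `(ya, yb; ca, cb)`
(`ca ya = cb yb = 1`; transvections `x ↦ x + cb x • ya`, `x ↦ x − ca x • yb` — K. Kondo arXiv:2512.09231 §2, Jannsen–Wingberg
NSW Thm. 7.5.14) MEANS, for any residue degree, over any nontrivially normed ultrametric field carrying a norm uniformizer:

* **`forall_twistStable_piBall_iff_norm_le`** — all balls `ϖ^m 𝒪` are stable under both transvections IFF the plane is SHORT: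
  `‖cb x‖·‖ya‖ ≤ ‖x‖` and `‖ca x‖·‖yb‖ ≤ ‖x‖` for every `x` (⇒: every `x ≠ 0` lies on the sphere of SOME ball `‖ϖ‖^m = ‖x‖`
  — the value group is `‖ϖ‖^ℤ` —, and `cb x • ya = (x + cb x • ya) − x`; ⇐: ultrametric inequality);
* **`norm_eq_of_forall_twistStable_piBall`** — hence stability forces `‖ya‖ = ‖yb‖` (`x = yb`, `x = ya`);
* **`exists_mapsOut_piBall_of_norm_ne`** — contrapositive MOVER CRITERION, parity-free: if `‖ya‖ ≠ ‖yb‖` (or the plane is not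
  short) then some point of some ball `ϖ^m 𝒪` is carried OUT of it by one of the two transvections;
* §2 AT THE REAL LOG-SHELL: **`Real.mapsOut_closedBall_or_short_of_plane`** — for `ψ, ψ' ∈ Real.ind1StripOf v L` acting on `K_v`
  (abc-iut-S7's rescaled norm) as the transvection pair of a twist plane (BINDERS, as in the movers): EITHER some `𝔪_v^m` has a
  point carried out of it by `ψ` or `ψ'`, OR the plane is `v`-adically short, in particular `‖ya‖ = ‖yb‖`.
So what print (NSW 7.5.14 / Kondo §2 / Hoshi–Nishio Lem. 1.3) does NOT pin — the `v`-adic shape of the Jannsen–Wingberg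
log-basis — is EXACTLY what decides region-rigidity of print's (Ind1) strip part at the places the parity count misses.
Classical ultrametric linear algebra; [claim: Mochizuki2012, status: disputed] for every [IUTchIII] quotation;
[cite: NeukirchSchmidtWingberg2008, Thm 7.5.14]; [cite: Kondo2025OuterAutMLF, §2 Thm 2.1 and proof of Thm 2.3 p.10];
[cite: DupuyHilado2025, §4.7].  typed ≠ proved.
-/

set_option autoImplicit false

noncomputable section

open Metric Set

namespace Summit.ABC.IUTFork.Thm311.TwistLattice

open Literature.NumberTheory.GaloisRepresentations.Ultrametric

/-! ## 1. Stability of all balls under one plane ⟺ shortness of the plane -/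

section Short

variable {𝕜 : Type*} [NormedField 𝕜] {K : Type*} [NontriviallyNormedField K] [NormedAlgebra 𝕜 K] [IsUltrametricDist K]

/-- **All balls `ϖ^m 𝒪` are stable under the transvection `x ↦ x + c x • y` iff `‖c x‖·‖y‖ ≤ ‖x‖` for all `x`.**
(⇒: for `x ≠ 0`, `‖x‖ = ‖ϖ‖^m` for some `m` since the value group is `‖ϖ‖^ℤ`, and `c x • y = (x + c x • y) − x` has norm
`≤ ‖ϖ‖^m`; ⇐: the ultrametric inequality.) [folklore] -/
theorem forall_stable_piBall_iff_norm_smul_le {ϖ : Kˣ} (hϖ : IsUniformizer ϖ) (c : K →ₗ[𝕜] 𝕜) (y : K) :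
    (∀ m : ℤ, ∀ x ∈ (piBall (ϖ ^ m) : OpenAddSubgroup K).toAddSubgroup,
        x + c x • y ∈ (piBall (ϖ ^ m) : OpenAddSubgroup K).toAddSubgroup) ↔
      ∀ x : K, ‖c x • y‖ ≤ ‖x‖ := by
  constructor
  · intro h x
    rcases eq_or_ne x 0 with rfl | hx0
    · rw [map_zero, zero_smul, norm_zero]
    · obtain ⟨m, hm⟩ := hϖ.2 (Units.mk0 x hx0)
      rw [Units.val_mk0] at hm
      have hxm : x ∈ (piBall (ϖ ^ m) : OpenAddSubgroup K).toAddSubgroup := by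
        rw [mem_toAddSubgroup_piBall, Units.val_zpow_eq_zpow_val, norm_zpow, hm]
      have h1 := h m x hxm
      rw [mem_toAddSubgroup_piBall, Units.val_zpow_eq_zpow_val, norm_zpow, ← hm] at h1
      calc ‖c x • y‖ = ‖(x + c x • y) + -x‖ := by rw [← sub_eq_add_neg, add_sub_cancel_left]
        _ ≤ max ‖x + c x • y‖ ‖-x‖ := IsUltrametricDist.norm_add_le_max _ _
        _ ≤ ‖x‖ := max_le h1 (by rw [norm_neg])
  · intro h m x hx
    rw [mem_toAddSubgroup_piBall] at hx ⊢
    calc ‖x + c x • y‖ ≤ max ‖x‖ ‖c x • y‖ := IsUltrametricDist.norm_add_le_max _ _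
      _ ≤ ‖x‖ := max_le le_rfl (h x)
      _ ≤ _ := hx

/-- The same for the second transvection `x ↦ x − c x • y` of a plane. [folklore] -/
theorem forall_stable_piBall_sub_iff_norm_smul_le {ϖ : Kˣ} (hϖ : IsUniformizer ϖ) (c : K →ₗ[𝕜] 𝕜) (y : K) :
    (∀ m : ℤ, ∀ x ∈ (piBall (ϖ ^ m) : OpenAddSubgroup K).toAddSubgroup,
        x - c x • y ∈ (piBall (ϖ ^ m) : OpenAddSubgroup K).toAddSubgroup) ↔
      ∀ x : K, ‖c x • y‖ ≤ ‖x‖ := by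
  have h := forall_stable_piBall_iff_norm_smul_le hϖ c (-y)
  simp only [smul_neg, norm_neg, ← sub_eq_add_neg] at h
  exact h

/-- **Region-rigidity under ONE twist plane ⟺ the plane is SHORT.**  For a twist plane `(ya, yb; ca, cb)` of `K` over `𝕜`
and a norm uniformizer `ϖ`: all balls `ϖ^m 𝒪` (`m ∈ ℤ`) are stable under both transvections `x ↦ x + cb x • ya`,
`x ↦ x − ca x • yb` iff `‖cb x • ya‖ ≤ ‖x‖` and `‖ca x • yb‖ ≤ ‖x‖` for all `x`. [folklore] -/
theorem forall_twistStable_piBall_iff_norm_le {ϖ : Kˣ} (hϖ : IsUniformizer ϖ) (ca cb : K →ₗ[𝕜] 𝕜) (ya yb : K) :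
    (∀ m : ℤ, (∀ x ∈ (piBall (ϖ ^ m) : OpenAddSubgroup K).toAddSubgroup,
          x + cb x • ya ∈ (piBall (ϖ ^ m) : OpenAddSubgroup K).toAddSubgroup) ∧
        (∀ x ∈ (piBall (ϖ ^ m) : OpenAddSubgroup K).toAddSubgroup,
          x - ca x • yb ∈ (piBall (ϖ ^ m) : OpenAddSubgroup K).toAddSubgroup)) ↔
      (∀ x : K, ‖cb x • ya‖ ≤ ‖x‖) ∧ (∀ x : K, ‖ca x • yb‖ ≤ ‖x‖) := by
  rw [← forall_stable_piBall_iff_norm_smul_le hϖ cb ya, ← forall_stable_piBall_sub_iff_norm_smul_le hϖ ca yb]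
  exact ⟨fun h => ⟨fun m => (h m).1, fun m => (h m).2⟩, fun h m => ⟨h.1 m, h.2 m⟩⟩

/-- **Stability of all balls under a twist plane forces `‖ya‖ = ‖yb‖`** (shortness at `x = yb`: `‖ya‖ ≤ ‖yb‖` since
`cb yb = 1`; at `x = ya`: `‖yb‖ ≤ ‖ya‖`). [folklore] -/
theorem norm_eq_of_forall_twistStable_piBall {ϖ : Kˣ} (hϖ : IsUniformizer ϖ) {ca cb : K →ₗ[𝕜] 𝕜} {ya yb : K}
    (hca : ca ya = 1) (hcb : cb yb = 1)
    (h : ∀ m : ℤ, (∀ x ∈ (piBall (ϖ ^ m) : OpenAddSubgroup K).toAddSubgroup,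
          x + cb x • ya ∈ (piBall (ϖ ^ m) : OpenAddSubgroup K).toAddSubgroup) ∧
        (∀ x ∈ (piBall (ϖ ^ m) : OpenAddSubgroup K).toAddSubgroup,
          x - ca x • yb ∈ (piBall (ϖ ^ m) : OpenAddSubgroup K).toAddSubgroup)) :
    ‖ya‖ = ‖yb‖ := by
  rw [forall_twistStable_piBall_iff_norm_le hϖ] at h
  have h1 := h.1 yb
  have h2 := h.2 ya
  rw [hcb, one_smul] at h1
  rw [hca, one_smul] at h2
  exact le_antisymm h1 h2

/-- **Parity-free MOVER CRITERION.**  If the twist plane is NOT short — in particular (`ca ya = cb yb = 1`) if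
`‖ya‖ ≠ ‖yb‖` — then some point of some ball `ϖ^m 𝒪` is carried OUT of it by one of the two transvections. [folklore] -/
theorem exists_mapsOut_piBall_of_norm_ne {ϖ : Kˣ} (hϖ : IsUniformizer ϖ) {ca cb : K →ₗ[𝕜] 𝕜} {ya yb : K}
    (hca : ca ya = 1) (hcb : cb yb = 1) (hne : ‖ya‖ ≠ ‖yb‖) :
    ∃ m : ℤ, ∃ x : K, ‖x‖ ≤ ‖(ϖ : K)‖ ^ m ∧
      (‖(ϖ : K)‖ ^ m < ‖x + cb x • ya‖ ∨ ‖(ϖ : K)‖ ^ m < ‖x - ca x • yb‖) := by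
  by_contra hcon
  push Not at hcon
  apply hne (norm_eq_of_forall_twistStable_piBall hϖ hca hcb ?_)
  intro m
  have hball : ∀ x : K, x ∈ (piBall (ϖ ^ m) : OpenAddSubgroup K).toAddSubgroup ↔ ‖x‖ ≤ ‖(ϖ : K)‖ ^ m := by
    intro x
    rw [mem_toAddSubgroup_piBall, Units.val_zpow_eq_zpow_val, norm_zpow]
  refine ⟨fun x hx => ?_, fun x hx => ?_⟩
  · rw [hball] at hx ⊢
    exact (hcon m x hx).1
  · rw [hball] at hx ⊢
    exact (hcon m x hx).2

end Short

end Summit.ABC.IUTFork.Thm311.TwistLattice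

/-! ## 2. At the real log-shell `K_v`: a realised plane either inflates a ball or is `v`-adically short -/

namespace Summit.ABC.IUTFork.Thm311.Real

open NumberField IsDedekindDomain Literature.NumberTheory.NumberFields Literature.IUT.LogVolume
open Literature.NumberTheory.GaloisRepresentations.Ultrametric Summit.ABC.IUTFork.Thm311.TwistLattice

variable {F : Type} [Field F] [NumberField F] (p : ℕ) [Fact p.Prime] (v : HeightOneSpectrum (𝓞 F))
  (hv : ((p : ℕ) : 𝓞 F) ∈ v.asIdeal)

/-- **DICHOTOMY at `v` for ONE realised twist plane (any `f(v|p)`).**  Let `ψ, ψ' ∈ Real.ind1StripOf v L` act on `K_v`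
(abc-iut-S7's rescaled norm, `of : K_v ≃+* K`) as the transvection pair `x ↦ x + cb x • ya`, `x ↦ x − ca x • yb` of a twist
plane over `ℚ_p` (`ca ya = cb yb = 1`; BINDERS, supplied for the Jannsen–Wingberg planes by `DehnTwistTransvectionsOnUnitsAll`).
Then EITHER for some `m ∈ ℤ` some point of `𝔪_v^m = B(0,‖ϖ‖^m)` is carried OUT of `𝔪_v^m` by `ψ` or by `ψ'` (the (Ind1)-hull
of that region is strictly larger), OR the plane is `v`-adically SHORT — `‖cb x • ya‖ ≤ ‖x‖`, `‖ca x • yb‖ ≤ ‖x‖` for all `x` —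
and in particular `‖ya‖ = ‖yb‖`.  (Print does not pin the `v`-adic shape of the Jannsen–Wingberg log-basis; this is exactly
the datum that decides region-rigidity where the parity count of `Thm311RealInd1StripTwistMoverOdd` is silent.)
[claim: Mochizuki2012, status: disputed] [cite: NeukirchSchmidtWingberg2008, Thm 7.5.14] [cite: DupuyHilado2025, §4.7] -/
theorem mapsOut_closedBall_or_short_of_plane (L : Additive (↥(v.adicCompletionIntegers F))ˣ →+ v.adicCompletion F)
    {ϖ : (RescaledCompletion F p v hv)ˣ} (hϖ : IsUniformizer ϖ)
    {ca cb : RescaledCompletion F p v hv →ₗ[ℚ_[p]] ℚ_[p]} {ya yb : RescaledCompletion F p v hv}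
    (hca : ca ya = 1) (hcb : cb yb = 1)
    {ψ ψ' : v.adicCompletion F ≃+ v.adicCompletion F} (hψ : ψ ∈ ind1StripOf v L) (hψ' : ψ' ∈ ind1StripOf v L)
    (hT : ∀ x : RescaledCompletion F p v hv,
      RescaledCompletion.of F p v hv (ψ ((RescaledCompletion.of F p v hv).symm x)) = x + cb x • ya)
    (hT' : ∀ x : RescaledCompletion F p v hv,
      RescaledCompletion.of F p v hv (ψ' ((RescaledCompletion.of F p v hv).symm x)) = x - ca x • yb) :
    (∃ χ ∈ ind1StripOf v L, ∃ m : ℤ,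
      ∃ x ∈ closedBall (0 : RescaledCompletion F p v hv) (‖(ϖ : RescaledCompletion F p v hv)‖ ^ m),
        RescaledCompletion.of F p v hv (χ ((RescaledCompletion.of F p v hv).symm x)) ∉
          closedBall (0 : RescaledCompletion F p v hv) (‖(ϖ : RescaledCompletion F p v hv)‖ ^ m)) ∨
    ((∀ x : RescaledCompletion F p v hv, ‖cb x • ya‖ ≤ ‖x‖) ∧ (∀ x : RescaledCompletion F p v hv, ‖ca x • yb‖ ≤ ‖x‖) ∧
      ‖ya‖ = ‖yb‖) := by
  by_cases hshort : (∀ x : RescaledCompletion F p v hv, ‖cb x • ya‖ ≤ ‖x‖) ∧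
      (∀ x : RescaledCompletion F p v hv, ‖ca x • yb‖ ≤ ‖x‖)
  · refine Or.inr ⟨hshort.1, hshort.2, ?_⟩
    exact norm_eq_of_forall_twistStable_piBall hϖ hca hcb ((forall_twistStable_piBall_iff_norm_le hϖ ca cb ya yb).mpr hshort)
  · left
    rw [← forall_twistStable_piBall_iff_norm_le hϖ ca cb ya yb] at hshort
    push Not at hshort
    obtain ⟨m, hm⟩ := hshort
    have hball : ∀ x : RescaledCompletion F p v hv,
        x ∈ (piBall (ϖ ^ m) : OpenAddSubgroup (RescaledCompletion F p v hv)).toAddSubgroup ↔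
          x ∈ closedBall (0 : RescaledCompletion F p v hv) (‖(ϖ : RescaledCompletion F p v hv)‖ ^ m) := by
      intro x
      rw [mem_toAddSubgroup_piBall, mem_closedBall_zero_iff, Units.val_zpow_eq_zpow_val, norm_zpow]
    by_cases h1 : ∀ x ∈ (piBall (ϖ ^ m) : OpenAddSubgroup (RescaledCompletion F p v hv)).toAddSubgroup,
        x + cb x • ya ∈ (piBall (ϖ ^ m) : OpenAddSubgroup (RescaledCompletion F p v hv)).toAddSubgroup
    · obtain ⟨x, hx, hout⟩ := hm h1
      refine ⟨ψ', hψ', m, x, (hball x).mp hx, ?_⟩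
      rw [hT', ← hball]
      exact hout
    · push Not at h1
      obtain ⟨x, hx, hout⟩ := h1
      refine ⟨ψ, hψ, m, x, (hball x).mp hx, ?_⟩
      rw [hT, ← hball]
      exact hout

end Summit.ABC.IUTFork.Thm311.Real

end
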